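import Literature.NumberTheory.Transcendental.KZIntervalPeriodProofs
import Literature.NumberTheory.Transcendental.SemialgebraicLineDeriv
import Literature.NumberTheory.Transcendental.KZCubicalCalculus
import Summits.KontsevichZagierPeriods.KontsevichZagierPeriods.Theorems.UnfoldedStokesStokesGenerationStubRungAngularCertificate
import Summits.KontsevichZagierPeriods.KontsevichZagierPeriods.Theorems.UnfoldedStokesStokesGenerationStubSwapTransport
import Summits.KontsevichZagierPeriods.KontsevichZagierPeriods.Theorems.UnfoldedStokesStokesGenerationFibrewiseClosureMulFresh
import Mathlib.Analysis.Calculus.Deriv.Inv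
import Mathlib.Analysis.Calculus.Deriv.Mul
import Mathlib.Analysis.Calculus.Deriv.Pow

/-!
# `StokesGeneration` (stmt-KontsevichZagierPeriods-3586) — line `fibrewise_stokes`, stub `stub_paramHalfAngleCertificate`

Registered stub V2 (rung 9, wave 2) of the line `fibrewise_stokes` of the crux `StokesGeneration`
(route UnfoldedStokes): **the two-element half-angle certificate, with a silent parameter, for the
angular derivative of a `y`-segment loop between two right-half-plane points** on the closed cube
`[0,1]⁴` (loop variable `y = x 2`, auxiliary variable `w = x 3`, parameter `p = x a`, `a ∉ {2, 3}`).

Rung 9 transposes angular atoms between coordinates; the transport leaves the segment loops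
`ℓ(y) = (1 − y) z₀(p) + y z₁(p)` between the two points `z_c(p) = re_c p + i im_c p` of the open
right half plane (`re₀, re₁ > 0` on `[0,1]`). Write `R = Re ℓ = (1 − y) re₀ + y re₁ > 0` (a convex
combination of positives), `I = Im ℓ = (1 − y) im₀ + y im₁` and `N = im₁ re₀ − re₁ im₀`, so that
`∂_y I · R − ∂_y R · I = N` (the `y`-terms cancel) and the angular derivative of the loop is
`ω = Im(ℓ′ conj ℓ)/|ℓ|² = N/(R² + I²)`. Exactly as in rung 3 (`stub_rungAngularCertificate`, the
case without parameter), `ω` is the `w`-integral over `[0,1]` of `∂_y` of the half-angle kernel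
`K = R I/(R² + I² w²) = T/(1 + T² w²)`, `T = I/R` (`∫₀¹ K dw = arctan T`), up to an exact
correction in the `w`-direction: with `E = R² + I² w² ≥ R² > 0` and `E₁ = R² + I²`, the primitives
`G₀ = γ R I/E` (direction `2`) and `G₁ = γ w N (1/E₁ − 1/E)` (direction `3`) have fibre derivatives
`D₀ = γ N (R² − I² w²)/E²`, `D₁ = γ N (1/E₁ − (R² − I² w²)/E²)` with `D₀ + D₁ = γ N/E₁ = γ ω`; both
boundary values of `G₁` vanish (the factor `w`, and `E|_{w=1} = E₁`), while the faces of `G₀` are the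
half-angle kernels of the two endpoints, `G₀|_{y=c} = γ re_c im_c/(re_c² + im_c² w²) =
γ T_c/(1 + T_c² w²)`, `T_c = im_c/re_c` (`c = 0, 1`). Hence the sum of the two fibrewise Stokes
elements `Dⱼ − (Gⱼ|₁ − Gⱼ|₀)` is `γ ω − γ (T₁/(1 + T₁² w²) − T₀/(1 + T₀² w²))`, all data being rational,
with denominators positive on the cube, in `y`, `w`, `γ` and the four one-variable `ℚ`-semialgebraic
functions read on the coordinate `a` — `ℚ`-semialgebraic (Bochnak–Coste–Roy, Prop. 2.2.6; reading a
semialgebraic function through a coordinate map preserves semialgebraicity) and continuous on the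
compact cube, hence bounded and integrable; there is no kink set. The one-variable calculus along
the fibres is rung 3's (`rungAng_hasDerivAt_dir0`, `rungAng_hasDerivAt_dir1`).

References: J. Ayoub, *Une version relative de la conjecture des périodes de Kontsevich–Zagier*,
Ann. of Math. 181 (2015), Rem. 1.5; M. Kontsevich, D. Zagier, *Periods* (2001), §1.2;
J. Bochnak, M. Coste, M.-F. Roy, *Real Algebraic Geometry* (1998), Prop. 2.2.6.
-/

noncomputable section

-- `Summit.KontsevichZagierPeriods.KontsevichZagierPeriods.…` is the tree's mandated layout (single-conjunct summit).
set_option linter.dupNamespace false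

namespace Summit.KontsevichZagierPeriods.KontsevichZagierPeriods.Cruxes.StokesGeneration.FibrewiseStokes

open MeasureTheory Set
open Literature.NumberTheory.Transcendental
open Literature.NumberTheory.Transcendental.KZ
open Literature.ModelTheory.ExponentialFields (IsSemialgebraic)

/-! ## Elementary algebra and one-variable calculus -/

/-- The half-angle kernel of a right-half-plane point in slope form and in Cartesian form:
`(i/r)/(1 + (i/r)² w²) = r i/(r² + i² w²)` for `r ≠ 0` (numerator and denominator multiplied by
`r²`). [folklore] -/
theorem paramHalfAng_face (i w : ℝ) {r : ℝ} (hr : r ≠ 0) :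
    (i / r) / (1 + (i / r) ^ 2 * w ^ 2) = r * i / (r ^ 2 + i ^ 2 * w ^ 2) := by
  have h2 : r ^ 2 + i ^ 2 * w ^ 2 ≠ 0 := by positivity
  field_simp

/-- A one-variable `ℚ`-semialgebraic function `g` (semialgebraic as `z ↦ g (z 0)` on the cube of
`ℝ¹`), read on the coordinate `a` of the closed cube `[0,1]⁴`, is `ℚ`-semialgebraic there (the new
graph is a coordinate preimage of the old one). [folklore] -/
theorem paramHalfAng_sa_coord {g : ℝ → ℝ} (a : Fin 4)
    (hg : IsSemialgebraicFunOn ℚ (Set.pi Set.univ (fun _ : Fin 1 => Set.Icc (0:ℝ) 1)) (fun z => g (z 0))) :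
    IsSemialgebraicFunOn ℚ (Set.pi Set.univ (fun _ : Fin 4 => Set.Icc (0:ℝ) 1)) (fun x => g (x a)) := by
  have hS : IsSemialgebraic ℚ (Set.pi Set.univ (fun _ : Fin 4 => Set.Icc (0:ℝ) 1)) := by
    rw [← cube_eq_pi]; exact isSemialgebraic_cube
  refine (isSemialgebraicFunOn_comp_coord hg (fun _ : Fin 1 => a)).mono (fun y hy => ?_) hS
  simp only [Set.mem_setOf_eq, Set.mem_univ_pi]
  exact fun _ => hy a (Set.mem_univ _)

/-- Direction `2` (the half-angle kernel along the segment): for the affine functions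
`A u = (1 − u) r₀ + u r₁`, `B u = (1 − u) i₀ + u i₁` (so that `A B′ − A′ B = i₁ r₀ − r₁ i₀`) and
`A s² + B s² c ≠ 0`,
`d/du [γ A B/(A² + B² c)]|_{u=s} = γ (i₁ r₀ − r₁ i₀)(A s² − B s² c)/(A s² + B s² c)²`
(rung 3's quotient rule `rungAng_hasDerivAt_dir0`). [folklore] -/
theorem paramHalfAng_hasDerivAt_dir2 {γ r₀ r₁ i₀ i₁ c s : ℝ}
    (hE : ((1 - s) * r₀ + s * r₁) ^ 2 + ((1 - s) * i₀ + s * i₁) ^ 2 * c ≠ 0) :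
    HasDerivAt (fun u => γ * (((1 - u) * r₀ + u * r₁) * ((1 - u) * i₀ + u * i₁)) /
        (((1 - u) * r₀ + u * r₁) ^ 2 + ((1 - u) * i₀ + u * i₁) ^ 2 * c))
      (γ * ((i₁ * r₀ - r₁ * i₀) * (((1 - s) * r₀ + s * r₁) ^ 2 - ((1 - s) * i₀ + s * i₁) ^ 2 * c)) /
        (((1 - s) * r₀ + s * r₁) ^ 2 + ((1 - s) * i₀ + s * i₁) ^ 2 * c) ^ 2) s := by
  have hl : ∀ p q : ℝ, HasDerivAt (fun u : ℝ => (1 - u) * p + u * q) ((0 - 1) * p + 1 * q) s :=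
    fun p q => ((((hasDerivAt_const s (1:ℝ)).fun_sub (hasDerivAt_id' s)).mul_const p).fun_add
      ((hasDerivAt_id' s).mul_const q))
  refine (rungAng_hasDerivAt_dir0 (γ := γ) (c := c) (hl r₀ r₁) (hl i₀ i₁) hE).congr_deriv ?_
  ring

/-! ## The certificate -/

/-- **Registered stub `stub_paramHalfAngleCertificate` (rung 9, V2): the two-element half-angle
certificate with a silent parameter.** For `γ` real algebraic, a parameter coordinate `a ∉ {2, 3}`
of `[0,1]⁴` and one-variable continuous `ℚ`-semialgebraic `re₀, im₀, re₁, im₁` with `re₀, re₁ > 0`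
on `[0,1]`, the angular derivative `γ ω`, `ω = (im₁ re₀ − re₁ im₀)/(R² + I²)`
(`R = (1 − y) re₀ + y re₁`, `I = (1 − y) im₀ + y im₁`, `y = x 2`, functions of `p = x a`), of the
segment loop between the right-half-plane points `re_c + i im_c` is, up to the two half-angle faces
`γ (T₁/(1 + T₁² w²) − T₀/(1 + T₀² w²))` (`T_c = im_c/re_c`, `w = x 3`), the sum of two fibrewise
Stokes elements on the closed cube in the directions `![2, 3]`, with primitives
`G₀ = γ R I/(R² + I² w²)` and `G₁ = γ w (im₁ re₀ − re₁ im₀)(1/(R² + I²) − 1/(R² + I² w²))`, no kink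
set. [cite: Ayoub2015, Rem. 1.5] -/
theorem stub_paramHalfAngleCertificate :
    ∀ (γ : ℝ) (a : Fin 4) (re₀ im₀ re₁ im₁ : ℝ → ℝ), IsAlgebraic ℚ γ → a ≠ 2 → a ≠ 3 →
      IsSemialgebraicFunOn ℚ (Set.pi Set.univ (fun _ : Fin 1 => Set.Icc (0:ℝ) 1)) (fun z => re₀ (z 0)) →
      IsSemialgebraicFunOn ℚ (Set.pi Set.univ (fun _ : Fin 1 => Set.Icc (0:ℝ) 1)) (fun z => im₀ (z 0)) →
      IsSemialgebraicFunOn ℚ (Set.pi Set.univ (fun _ : Fin 1 => Set.Icc (0:ℝ) 1)) (fun z => re₁ (z 0)) →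
      IsSemialgebraicFunOn ℚ (Set.pi Set.univ (fun _ : Fin 1 => Set.Icc (0:ℝ) 1)) (fun z => im₁ (z 0)) →
      ContinuousOn re₀ (Set.Icc (0:ℝ) 1) → ContinuousOn im₀ (Set.Icc (0:ℝ) 1) →
      ContinuousOn re₁ (Set.Icc (0:ℝ) 1) → ContinuousOn im₁ (Set.Icc (0:ℝ) 1) →
      (∀ p ∈ Set.Icc (0:ℝ) 1, 0 < re₀ p) → (∀ p ∈ Set.Icc (0:ℝ) 1, 0 < re₁ p) →
      ∃ (G D : Fin 2 → (Fin 4 → ℝ) → ℝ) (r : Fin 2 → IntegralRep 4),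
        (∀ j, IsSemialgebraicFunOn ℚ (Set.pi Set.univ (fun _ : Fin 4 => Set.Icc (0:ℝ) 1)) (G j) ∧
          IsSemialgebraicFunOn ℚ (Set.pi Set.univ (fun _ : Fin 4 => Set.Icc (0:ℝ) 1)) (D j) ∧
          (∃ Bd : ℝ, ∀ x ∈ (Set.pi Set.univ (fun _ : Fin 4 => Set.Icc (0:ℝ) 1)), |(G j) x| ≤ Bd) ∧
          (∀ x ∈ (Set.pi Set.univ (fun _ : Fin 4 => Set.Icc (0:ℝ) 1)),
            ContinuousOn (fun s : ℝ => (G j) (Function.update x ((![2, 3] : Fin 2 → Fin 4) j) s)) (Set.Icc (0:ℝ) 1)) ∧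
          (∀ x ∈ (Set.pi Set.univ (fun _ : Fin 4 => Set.Icc (0:ℝ) 1)), x ((![2, 3] : Fin 2 → Fin 4) j) ∈ Set.Ioo (0:ℝ) 1 →
            HasDerivAt (fun s : ℝ => (G j) (Function.update x ((![2, 3] : Fin 2 → Fin 4) j) s)) ((D j) x)
              (x ((![2, 3] : Fin 2 → Fin 4) j)))) ∧
        (∀ j, (r j).domain = (Set.pi Set.univ (fun _ : Fin 4 => Set.Icc (0:ℝ) 1)) ∧
          ∀ x ∈ (Set.pi Set.univ (fun _ : Fin 4 => Set.Icc (0:ℝ) 1)), (r j).integrand x =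
            D j x - (G j (Function.update x ((![2, 3] : Fin 2 → Fin 4) j) 1) -
              G j (Function.update x ((![2, 3] : Fin 2 → Fin 4) j) 0))) ∧
        ∀ x ∈ (Set.pi Set.univ (fun _ : Fin 4 => Set.Icc (0:ℝ) 1)), ∑ j, (r j).integrand x =
          γ * ((im₁ (x a) * re₀ (x a) - re₁ (x a) * im₀ (x a)) /
                (((1 - x 2) * re₀ (x a) + x 2 * re₁ (x a)) ^ 2 + ((1 - x 2) * im₀ (x a) + x 2 * im₁ (x a)) ^ 2)) -
          γ * ((im₁ (x a) / re₁ (x a)) / (1 + (im₁ (x a) / re₁ (x a)) ^ 2 * x 3 ^ 2) -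
                (im₀ (x a) / re₀ (x a)) / (1 + (im₀ (x a) / re₀ (x a)) ^ 2 * x 3 ^ 2)) := by
  intro γ a re₀ im₀ re₁ im₁ hγ ha2 ha3 hre₀ him₀ hre₁ him₁ hre₀c him₀c hre₁c him₁c hpos₀ hpos₁
  -- the closed 4-cube and what holds on it
  set S : Set (Fin 4 → ℝ) := Set.pi Set.univ (fun _ : Fin 4 => Set.Icc (0:ℝ) 1) with hS
  have hSsa : IsSemialgebraic ℚ S := by rw [hS, ← cube_eq_pi]; exact isSemialgebraic_cube
  have hSc : IsCompact S := isCompact_univ_pi fun _ => isCompact_Icc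
  have h32 : (3 : Fin 4) ≠ 2 := by decide
  have h23 : (2 : Fin 4) ≠ 3 := by decide
  have hmem : ∀ x ∈ S, ∀ i, x i ∈ Set.Icc (0:ℝ) 1 := fun x hx i => (Set.mem_univ_pi.mp hx) i
  -- moving one coordinate inside `[0,1]` stays in the cube
  have hupd : ∀ x ∈ S, ∀ (i : Fin 4), ∀ s ∈ Set.Icc (0:ℝ) 1, Function.update x i s ∈ S := by
    intro x hx i s hs
    refine Set.mem_univ_pi.mpr fun l => ?_
    rcases eq_or_ne l i with rfl | hli
    · simpa using hs
    · rw [Function.update_of_ne hli]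
      exact hmem x hx l
  -- the real and imaginary parts `R`, `I` of the segment loop, and the constant numerator `N`
  set Rf : (Fin 4 → ℝ) → ℝ := fun x => (1 - x 2) * re₀ (x a) + x 2 * re₁ (x a) with hRf
  set Jf : (Fin 4 → ℝ) → ℝ := fun x => (1 - x 2) * im₀ (x a) + x 2 * im₁ (x a) with hJf
  set Nf : (Fin 4 → ℝ) → ℝ := fun x => im₁ (x a) * re₀ (x a) - re₁ (x a) * im₀ (x a) with hNf
  -- positivity: `re₀, re₁ > 0`, `R > 0` (convex combination), `E = R² + I² w² > 0`, `E₁ = R² + I² > 0`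
  have hre₀ne : ∀ x ∈ S, re₀ (x a) ≠ 0 := fun x hx => (hpos₀ _ (hmem x hx a)).ne'
  have hre₁ne : ∀ x ∈ S, re₁ (x a) ≠ 0 := fun x hx => (hpos₁ _ (hmem x hx a)).ne'
  have hRpos : ∀ x ∈ S, 0 < Rf x := fun x hx =>
    swapTr_combo_pos (hpos₁ _ (hmem x hx a)) (hpos₀ _ (hmem x hx a)) (hmem x hx 2)
  have hE1pos : ∀ x ∈ S, 0 < Rf x ^ 2 + Jf x ^ 2 := fun x hx =>
    add_pos_of_pos_of_nonneg (pow_pos (hRpos x hx) 2) (sq_nonneg _)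
  have hEpos : ∀ x ∈ S, 0 < Rf x ^ 2 + Jf x ^ 2 * x 3 ^ 2 := fun x hx =>
    add_pos_of_pos_of_nonneg (pow_pos (hRpos x hx) 2) (mul_nonneg (sq_nonneg _) (sq_nonneg _))
  have hE1ne : ∀ x ∈ S, Rf x ^ 2 + Jf x ^ 2 ≠ 0 := fun x hx => (hE1pos x hx).ne'
  have hEne : ∀ x ∈ S, Rf x ^ 2 + Jf x ^ 2 * x 3 ^ 2 ≠ 0 := fun x hx => (hEpos x hx).ne'
  have hE2ne : ∀ x ∈ S, (Rf x ^ 2 + Jf x ^ 2 * x 3 ^ 2) ^ 2 ≠ 0 := fun x hx =>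
    pow_ne_zero 2 (hEne x hx)
  have hface₀ne : ∀ x ∈ S, re₀ (x a) ^ 2 + im₀ (x a) ^ 2 * x 3 ^ 2 ≠ 0 := fun x hx =>
    (add_pos_of_pos_of_nonneg (pow_pos (hpos₀ _ (hmem x hx a)) 2)
      (mul_nonneg (sq_nonneg _) (sq_nonneg _))).ne'
  have hface₁ne : ∀ x ∈ S, re₁ (x a) ^ 2 + im₁ (x a) ^ 2 * x 3 ^ 2 ≠ 0 := fun x hx =>
    (add_pos_of_pos_of_nonneg (pow_pos (hpos₁ _ (hmem x hx a)) 2)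
      (mul_nonneg (sq_nonneg _) (sq_nonneg _))).ne'
  -- semialgebraic atoms and building blocks on the cube (BCR Prop. 2.2.6)
  have hysa : IsSemialgebraicFunOn ℚ S (fun x => x 2) := isSemialgebraicFunOn_apply hSsa 2
  have hwsa : IsSemialgebraicFunOn ℚ S (fun x => x 3) := isSemialgebraicFunOn_apply hSsa 3
  have hγsa : IsSemialgebraicFunOn ℚ S (fun _ => γ) :=
    isSemialgebraicFunOn_const_of_isAlgebraic hSsa hγ
  have h1sa : IsSemialgebraicFunOn ℚ S (fun _ => (1:ℝ)) :=
    isSemialgebraicFunOn_const_of_isAlgebraic hSsa isAlgebraic_one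
  have h1ysa : IsSemialgebraicFunOn ℚ S (fun x => 1 - x 2) := h1sa.fun_sub hysa
  have hre₀S : IsSemialgebraicFunOn ℚ S (fun x => re₀ (x a)) := paramHalfAng_sa_coord a hre₀
  have him₀S : IsSemialgebraicFunOn ℚ S (fun x => im₀ (x a)) := paramHalfAng_sa_coord a him₀
  have hre₁S : IsSemialgebraicFunOn ℚ S (fun x => re₁ (x a)) := paramHalfAng_sa_coord a hre₁
  have him₁S : IsSemialgebraicFunOn ℚ S (fun x => im₁ (x a)) := paramHalfAng_sa_coord a him₁
  have hRsa : IsSemialgebraicFunOn ℚ S Rf := (h1ysa.fun_mul hre₀S).fun_add (hysa.fun_mul hre₁S)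
  have hIsa : IsSemialgebraicFunOn ℚ S Jf := (h1ysa.fun_mul him₀S).fun_add (hysa.fun_mul him₁S)
  have hNsa : IsSemialgebraicFunOn ℚ S Nf := (him₁S.fun_mul hre₀S).fun_sub (hre₁S.fun_mul him₀S)
  have hE1sa : IsSemialgebraicFunOn ℚ S (fun x => Rf x ^ 2 + Jf x ^ 2) :=
    (hRsa.fun_pow 2).fun_add (hIsa.fun_pow 2)
  have hEsa : IsSemialgebraicFunOn ℚ S (fun x => Rf x ^ 2 + Jf x ^ 2 * x 3 ^ 2) :=
    (hRsa.fun_pow 2).fun_add ((hIsa.fun_pow 2).fun_mul (hwsa.fun_pow 2))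
  have hMsa : IsSemialgebraicFunOn ℚ S (fun x => Rf x ^ 2 - Jf x ^ 2 * x 3 ^ 2) :=
    (hRsa.fun_pow 2).fun_sub ((hIsa.fun_pow 2).fun_mul (hwsa.fun_pow 2))
  -- continuity atoms and building blocks on the cube
  have hyS : ContinuousOn (fun x : Fin 4 → ℝ => x 2) S := (continuous_apply 2).continuousOn
  have hwS : ContinuousOn (fun x : Fin 4 → ℝ => x 3) S := (continuous_apply 3).continuousOn
  have h1yS : ContinuousOn (fun x : Fin 4 → ℝ => 1 - x 2) S := continuousOn_const.fun_sub hyS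
  have hre₀C : ContinuousOn (fun x : Fin 4 → ℝ => re₀ (x a)) S :=
    hre₀c.comp (continuous_apply a).continuousOn fun x hx => hmem x hx a
  have him₀C : ContinuousOn (fun x : Fin 4 → ℝ => im₀ (x a)) S :=
    him₀c.comp (continuous_apply a).continuousOn fun x hx => hmem x hx a
  have hre₁C : ContinuousOn (fun x : Fin 4 → ℝ => re₁ (x a)) S :=
    hre₁c.comp (continuous_apply a).continuousOn fun x hx => hmem x hx a
  have him₁C : ContinuousOn (fun x : Fin 4 → ℝ => im₁ (x a)) S :=
    him₁c.comp (continuous_apply a).continuousOn fun x hx => hmem x hx a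
  have hRC : ContinuousOn Rf S := (h1yS.fun_mul hre₀C).fun_add (hyS.fun_mul hre₁C)
  have hIC : ContinuousOn Jf S := (h1yS.fun_mul him₀C).fun_add (hyS.fun_mul him₁C)
  have hNC : ContinuousOn Nf S := (him₁C.fun_mul hre₀C).fun_sub (hre₁C.fun_mul him₀C)
  have hE1C : ContinuousOn (fun x => Rf x ^ 2 + Jf x ^ 2) S := (hRC.pow 2).fun_add (hIC.pow 2)
  have hEC : ContinuousOn (fun x => Rf x ^ 2 + Jf x ^ 2 * x 3 ^ 2) S :=
    (hRC.pow 2).fun_add ((hIC.pow 2).fun_mul (hwS.pow 2))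
  have hE2C : ContinuousOn (fun x => (Rf x ^ 2 + Jf x ^ 2 * x 3 ^ 2) ^ 2) S := hEC.pow 2
  have hMC : ContinuousOn (fun x => Rf x ^ 2 - Jf x ^ 2 * x 3 ^ 2) S :=
    (hRC.pow 2).fun_sub ((hIC.pow 2).fun_mul (hwS.pow 2))
  -- the witnesses, the two faces of `G₀` (`y = 1, 0`) and the integrand of element `0`
  set G0 : (Fin 4 → ℝ) → ℝ := fun x => γ * (Rf x * Jf x) / (Rf x ^ 2 + Jf x ^ 2 * x 3 ^ 2) with hG0
  set D0 : (Fin 4 → ℝ) → ℝ := fun x =>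
    γ * (Nf x * (Rf x ^ 2 - Jf x ^ 2 * x 3 ^ 2)) / (Rf x ^ 2 + Jf x ^ 2 * x 3 ^ 2) ^ 2 with hD0
  set G1 : (Fin 4 → ℝ) → ℝ := fun x =>
    γ * x 3 * Nf x * (1 / (Rf x ^ 2 + Jf x ^ 2) - 1 / (Rf x ^ 2 + Jf x ^ 2 * x 3 ^ 2)) with hG1
  set D1 : (Fin 4 → ℝ) → ℝ := fun x =>
    γ * Nf x * (1 / (Rf x ^ 2 + Jf x ^ 2) -
      (Rf x ^ 2 - Jf x ^ 2 * x 3 ^ 2) / (Rf x ^ 2 + Jf x ^ 2 * x 3 ^ 2) ^ 2) with hD1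
  set F1 : (Fin 4 → ℝ) → ℝ := fun x =>
    γ * (re₁ (x a) * im₁ (x a)) / (re₁ (x a) ^ 2 + im₁ (x a) ^ 2 * x 3 ^ 2) with hF1
  set F0 : (Fin 4 → ℝ) → ℝ := fun x =>
    γ * (re₀ (x a) * im₀ (x a)) / (re₀ (x a) ^ 2 + im₀ (x a) ^ 2 * x 3 ^ 2) with hF0
  set I0 : (Fin 4 → ℝ) → ℝ := fun x => D0 x - (F1 x - F0 x) with hI0
  -- semialgebraicity (closure under field operations, BCR Prop. 2.2.6)
  have hG0sa : IsSemialgebraicFunOn ℚ S G0 := (hγsa.fun_mul (hRsa.fun_mul hIsa)).div hEsa hEne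
  have hD0sa : IsSemialgebraicFunOn ℚ S D0 :=
    (hγsa.fun_mul (hNsa.fun_mul hMsa)).div (hEsa.fun_pow 2) hE2ne
  have hG1sa : IsSemialgebraicFunOn ℚ S G1 :=
    ((hγsa.fun_mul hwsa).fun_mul hNsa).fun_mul
      ((h1sa.div hE1sa hE1ne).fun_sub (h1sa.div hEsa hEne))
  have hD1sa : IsSemialgebraicFunOn ℚ S D1 :=
    (hγsa.fun_mul hNsa).fun_mul ((h1sa.div hE1sa hE1ne).fun_sub (hMsa.div (hEsa.fun_pow 2) hE2ne))
  have hF1sa : IsSemialgebraicFunOn ℚ S F1 := (hγsa.fun_mul (hre₁S.fun_mul him₁S)).div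
    ((hre₁S.fun_pow 2).fun_add ((him₁S.fun_pow 2).fun_mul (hwsa.fun_pow 2))) hface₁ne
  have hF0sa : IsSemialgebraicFunOn ℚ S F0 := (hγsa.fun_mul (hre₀S.fun_mul him₀S)).div
    ((hre₀S.fun_pow 2).fun_add ((him₀S.fun_pow 2).fun_mul (hwsa.fun_pow 2))) hface₀ne
  have hI0sa : IsSemialgebraicFunOn ℚ S I0 := hD0sa.fun_sub (hF1sa.fun_sub hF0sa)
  -- continuity on the cube
  have hG0c : ContinuousOn G0 S := (continuousOn_const.fun_mul (hRC.fun_mul hIC)).div₀ hEC hEne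
  have hD0c : ContinuousOn D0 S := (continuousOn_const.fun_mul (hNC.fun_mul hMC)).div₀ hE2C hE2ne
  have hG1c : ContinuousOn G1 S :=
    ((continuousOn_const.fun_mul hwS).fun_mul hNC).fun_mul
      ((continuousOn_const.div₀ hE1C hE1ne).fun_sub (continuousOn_const.div₀ hEC hEne))
  have hD1c : ContinuousOn D1 S :=
    (continuousOn_const.fun_mul hNC).fun_mul
      ((continuousOn_const.div₀ hE1C hE1ne).fun_sub (hMC.div₀ hE2C hE2ne))
  have hF1c : ContinuousOn F1 S := (continuousOn_const.fun_mul (hre₁C.fun_mul him₁C)).div₀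
    ((hre₁C.pow 2).fun_add ((him₁C.pow 2).fun_mul (hwS.pow 2))) hface₁ne
  have hF0c : ContinuousOn F0 S := (continuousOn_const.fun_mul (hre₀C.fun_mul him₀C)).div₀
    ((hre₀C.pow 2).fun_add ((him₀C.pow 2).fun_mul (hwS.pow 2))) hface₀ne
  have hI0c : ContinuousOn I0 S := hD0c.fun_sub (hF1c.fun_sub hF0c)
  -- packaged as `Fin 2`-families (element `j` lives in direction `![2, 3] j`)
  set G : Fin 2 → (Fin 4 → ℝ) → ℝ := ![G0, G1] with hG
  set D : Fin 2 → (Fin 4 → ℝ) → ℝ := ![D0, D1] with hD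
  set I : Fin 2 → (Fin 4 → ℝ) → ℝ := ![I0, D1] with hI
  have hGsa : ∀ j, IsSemialgebraicFunOn ℚ S (G j) := Fin.forall_fin_two.2 ⟨hG0sa, hG1sa⟩
  have hDsa : ∀ j, IsSemialgebraicFunOn ℚ S (D j) := Fin.forall_fin_two.2 ⟨hD0sa, hD1sa⟩
  have hIsa' : ∀ j, IsSemialgebraicFunOn ℚ S (I j) := Fin.forall_fin_two.2 ⟨hI0sa, hD1sa⟩
  have hGc : ∀ j, ContinuousOn (G j) S := Fin.forall_fin_two.2 ⟨hG0c, hG1c⟩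
  have hIc : ∀ j, ContinuousOn (I j) S := Fin.forall_fin_two.2 ⟨hI0c, hD1c⟩
  -- the faces: `G₀|_{y=1} = F1`, `G₀|_{y=0} = F0`, and both faces of `G₁` vanish
  have hG0_one : ∀ x, G0 (Function.update x 2 1) = F1 x := fun x => by
    simp only [hG0, hF1, hRf, hJf, Function.update_self, Function.update_of_ne ha2,
      Function.update_of_ne h32]
    ring
  have hG0_zero : ∀ x, G0 (Function.update x 2 0) = F0 x := fun x => by
    simp only [hG0, hF0, hRf, hJf, Function.update_self, Function.update_of_ne ha2,
      Function.update_of_ne h32]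
    ring
  have hG1_one : ∀ x, G1 (Function.update x 3 1) = 0 := fun x => by
    simp only [hG1, hRf, hJf, hNf, Function.update_self, Function.update_of_ne ha3,
      Function.update_of_ne h23]
    ring
  have hG1_zero : ∀ x, G1 (Function.update x 3 0) = 0 := fun x => by
    simp only [hG1, Function.update_self]
    ring
  -- bounds on the compact cube
  have hGbd : ∀ j, ∃ Bd : ℝ, ∀ x ∈ S, |G j x| ≤ Bd := fun j => by
    obtain ⟨Bd, hBd⟩ := hSc.exists_bound_of_continuousOn (hGc j)
    exact ⟨Bd, fun x hx => by simpa only [Real.norm_eq_abs] using hBd x hx⟩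
  -- continuity along closed fibres
  have hGfib : ∀ j, ∀ x ∈ S, ContinuousOn
      (fun s : ℝ => G j (Function.update x ((![2, 3] : Fin 2 → Fin 4) j) s)) (Set.Icc (0:ℝ) 1) := by
    intro j x hx
    have hc : Continuous fun s : ℝ => Function.update x ((![2, 3] : Fin 2 → Fin 4) j) s :=
      continuous_const.update _ continuous_id
    exact (hGc j).comp hc.continuousOn fun s hs => hupd x hx _ s hs
  -- derivatives along the fibres: direction `2` for `G₀` (rung 3's kernel rule with the affine
  -- `R`, `I`), direction `3` for `G₁` (rung 3's correction rule, verbatim)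
  have hGder : ∀ j, ∀ x ∈ S, x ((![2, 3] : Fin 2 → Fin 4) j) ∈ Set.Ioo (0:ℝ) 1 →
      HasDerivAt (fun s : ℝ => G j (Function.update x ((![2, 3] : Fin 2 → Fin 4) j) s)) (D j x)
        (x ((![2, 3] : Fin 2 → Fin 4) j)) := by
    intro j
    fin_cases j <;> intro x hx _
    · show HasDerivAt (fun s : ℝ => G0 (Function.update x 2 s)) (D0 x) (x 2)
      have hfun : ∀ s, G0 (Function.update x 2 s) =
          γ * (((1 - s) * re₀ (x a) + s * re₁ (x a)) * ((1 - s) * im₀ (x a) + s * im₁ (x a))) /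
            (((1 - s) * re₀ (x a) + s * re₁ (x a)) ^ 2 +
              ((1 - s) * im₀ (x a) + s * im₁ (x a)) ^ 2 * x 3 ^ 2) := fun s => by
        simp only [hG0, hRf, hJf, Function.update_self, Function.update_of_ne ha2,
          Function.update_of_ne h32]
      simp only [hfun]
      exact paramHalfAng_hasDerivAt_dir2 (hEne x hx)
    · show HasDerivAt (fun s : ℝ => G1 (Function.update x 3 s)) (D1 x) (x 3)
      have hfun : ∀ s, G1 (Function.update x 3 s) =
          γ * s * Nf x * (1 / (Rf x ^ 2 + Jf x ^ 2) - 1 / (Rf x ^ 2 + Jf x ^ 2 * s ^ 2)) := fun s => by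
        simp only [hG1, hRf, hJf, hNf, Function.update_self, Function.update_of_ne ha3,
          Function.update_of_ne h23]
      simp only [hfun]
      exact rungAng_hasDerivAt_dir1 (hEne x hx)
  -- the two closed-cube representations
  let r : Fin 2 → IntegralRep 4 := fun j =>
    { domain := S
      integrand := I j
      isSemialgebraic_domain := hSsa
      isSemialgebraicFunOn_integrand := hIsa' j
      integrableOn := (hIc j).integrableOn_compact hSc }
  refine ⟨G, D, r, fun j => ⟨hGsa j, hDsa j, hGbd j, hGfib j, hGder j⟩, ?_, fun x hx => ?_⟩
  · -- the integrand clauses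
    intro j
    fin_cases j <;> refine ⟨rfl, fun x _ => ?_⟩
    · show D0 x - (F1 x - F0 x) = D0 x - (G0 (Function.update x 2 1) - G0 (Function.update x 2 0))
      rw [hG0_one, hG0_zero]
    · show D1 x = D1 x - (G1 (Function.update x 3 1) - G1 (Function.update x 3 0))
      rw [hG1_one, hG1_zero, sub_zero, sub_zero]
  · -- `Σ integrands = γ ω − γ (faces)`: `D₀ + D₁ = γ N/E₁ = γ ω`, and the faces in slope form
    rw [Fin.sum_univ_two, paramHalfAng_face (im₁ (x a)) (x 3) (hre₁ne x hx),
      paramHalfAng_face (im₀ (x a)) (x 3) (hre₀ne x hx)]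
    show D0 x - (F1 x - F0 x) + D1 x = _
    simp only [hD0, hD1, hF1, hF0, hNf, hRf, hJf]
    ring

end Summit.KontsevichZagierPeriods.KontsevichZagierPeriods.Cruxes.StokesGeneration.FibrewiseStokes
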